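import Literature.IUT.HodgeTheaters.GlobalFrobenioidsCyclotomeIsoOfIntegralLawsNonVacuity
import Literature.AnabelianGeometry.AbsoluteAnabelian.ZHatCompletionAdicCompleteness
import Mathlib.Algebra.MvPolynomial.Rename
import Mathlib.Algebra.MvPolynomial.CommRing
import Mathlib.RingTheory.Localization.FractionRing
import Mathlib.GroupTheory.Perm.Fin
import Mathlib.GroupTheory.OrderOfElement
import HarnessLib

/-!
# [IUTchI] Example 5.1 (v), pp. 127–128: the DATA of a non-abelian toy for the Kummer-rigidity law binders of the
# layer-5 certificate row `IUTchI:Ex5.1(v)` — an `S₃`-field with a fixed ray and one permuted orbit, and a Kummer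
# container `Ẑ × ℤ³` (proof-only existence packages; no model of `NFBridgeRecon` yet)

S. Mochizuki, *Inter-universal Teichmüller theory I*, kurims manuscript (May 2020), §5 Example 5.1 (v), p. 127
l. 13 – p. 128 l. 54 ([IUTchI] Ex 5.1 (v) pp.127–128) [claim: Mochizuki2012, status: disputed] (D-0012 claim key;
nothing disputed is asserted; no side is taken on [IUTchIII] Cor. 3.12).

Cell abc-iut, layer-5 certificate `Summits/ABC/IUTFork/Conditional/Layer5OfSEx51.lean` (row 1116,
`layer5_held_ex51v`; v0.2 `Layer5OfSV02.lean`, `layer5_held_ex51v_v2`).  abc-iut-w5-d110 proved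
(`GlobalFrobenioidsCoricRigidityLawsCentral.lean`, `NFBridgeRecon.not_laws_of_commutative`) that the N-side binder
block of that row has no model with commutative `π₁^rat(†𝒟^⊛)`.  The sibling file
`GlobalFrobenioidsCoricLawsNonVacuity.lean` (abc-iut-w4-d050) inhabits the block at a datum with `π₁^rat := S₃`; this
file supplies its two raw ingredients as EXISTENCE PACKAGES (so that the proof-only assembly stays short):

* `CoricLawsToy.exists_S3Field` — a field `K` (`:= Frac ℚ[x₀, x₁, x₂]`) with an action of `S₃ = Perm(Fin 3)` by ring
  automorphisms (permuting the variables: `MvPolynomial.renameEquiv` lifted by `IsFractionRing.ringEquivOfRingEquivHom`),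
  a FIXED multiplicative ray `c n := 2ⁿ` and a permuted injective family `x i := xᵢ` (`g • x i = x (g i)`), with the
  product-exclusion facts: `c n · x i ∈ {c m} ∪ {x j}` only for `n = 0`, `x i · x j` never (total degrees `1`, `2`
  versus `0`, `1`);
* `CoricLawsToy.exists_container` — a Kummer container `H` (`:= Ẑ × ℤ³`, `Ẑ` = the tree's REAL
  `completion (GrpCat.of (Multiplicative ℤ))` with `ZHatLevel.eta`) with an `S₃`-action (permuting `ℤ³`) and a
  `Ẑ^× = Aut(Ẑ)`-action (on the `Ẑ` factor), an injective fixed additive ray `z n := (η n, 0)`, an injective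
  equivariant family `v i := (1, eᵢ)` with the same product-exclusion pattern, the DIVISOR-TRANSPORT computation
  `z m = u • z n → u (η n) = η m`, and a "restriction" homomorphism `r` (`:=` second projection) under which the ray is
  torsion and the `v i` are not (input of the E51/L31 torsion criterion of v0.2).

HONEST FRAMING.  DEGENERATE TOY data (genuine side = the tree's REAL `Ẑ` / `Ẑ^×`); elementary algebra; it inhabits
ASSUMPTION LABELS of OUR certificate and asserts nothing of [IUTchI]; not a discharge, not a claim about the genuine
`Gal(L̄_C/L_C)`-datum; typed ≠ proved; no side is taken on [IUTchIII] Cor. 3.12.  PROOF-ONLY: no `def`, no `instance`,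
no `structure`, no new Prop fact.
-/

namespace Literature.IUT.HodgeTheaters

namespace NFBridgeRecon

namespace CoricLawsToy

open ProfiniteGrp ProfiniteGrp.ProfiniteCompletion MvPolynomial
open Literature.AnabelianGeometry.EtaleTheta Literature.AnabelianGeometry.EtaleTheta.ZHatLevel
open Literature.AnabelianGeometry.AbsoluteAnabelian (ZHatCompletion.mul_comm)

/-- **The `S₃`-field of the toy.**  There are a field `K` with an action of `S₃ = Perm(Fin 3)` by ring automorphisms,
a fixed ray `c : ℕ → K` (`c a · c b = c (a + b)`, `c 0 = 1`, injective, non-zero) and an injective non-zero family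
`x : Fin 3 → K` permuted by the action (`g • x i = x (g i)`), never meeting the ray, such that a product `c n · x i`
lies in `{c m} ∪ {x j}` only if `n = 0` and a product `x i · x j` never does.  [Model: `K = Frac ℚ[x₀,x₁,x₂]`,
`c n = 2ⁿ`, `x i = xᵢ`.] ([IUTchI] Ex 5.1 (v) p.127) [claim: Mochizuki2012, status: disputed] -/
theorem exists_S3Field :
    ∃ (K : Type) (_ : Field K) (_ : MulSemiringAction (Equiv.Perm (Fin 3)) K) (c : ℕ → K) (x : Fin 3 → K),
      (∀ (g : Equiv.Perm (Fin 3)) (n : ℕ), g • c n = c n) ∧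
      (∀ (g : Equiv.Perm (Fin 3)) (i : Fin 3), g • x i = x (g i)) ∧
      Function.Injective c ∧ Function.Injective x ∧ (∀ n i, c n ≠ x i) ∧ c 0 = 1 ∧
      (∀ a b, c a * c b = c (a + b)) ∧ (∀ n, c n ≠ 0) ∧ (∀ i, x i ≠ 0) ∧
      (∀ n i, c n * x i ∈ Set.range c ∪ Set.range x → n = 0) ∧
      (∀ i j, x i * x j ∉ Set.range c ∪ Set.range x) := by
  classical
  let A := MvPolynomial (Fin 3) ℚ
  let K := FractionRing (MvPolynomial (Fin 3) ℚ)
  let ψ : Equiv.Perm (Fin 3) →* RingAut A :=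
    { toFun := fun σ => (MvPolynomial.renameEquiv ℚ σ).toRingEquiv
      map_one' := by
        apply RingEquiv.ext
        intro p
        change rename (⇑(1 : Equiv.Perm (Fin 3))) p = p
        rw [Equiv.Perm.coe_one, rename_id_apply]
      map_mul' := fun σ τ => by
        apply RingEquiv.ext
        intro p
        change rename (⇑(σ * τ)) p = rename σ (rename τ p)
        rw [Equiv.Perm.coe_mul, rename_rename] }
  let φ : Equiv.Perm (Fin 3) →* RingAut K := (IsFractionRing.ringEquivOfRingEquivHom A K).comp ψ
  have hφX : ∀ (σ : Equiv.Perm (Fin 3)) (i : Fin 3),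
      φ σ (algebraMap A K (X i)) = algebraMap A K (X (σ i)) := by
    intro σ i
    change IsFractionRing.ringEquivOfRingEquiv (ψ σ) (algebraMap A K (X i)) = _
    rw [IsFractionRing.ringEquivOfRingEquiv_algebraMap]
    change algebraMap A K (rename σ (X i)) = _
    rw [rename_X]
  have hφC : ∀ (σ : Equiv.Perm (Fin 3)) (q : ℚ), φ σ (algebraMap A K (C q)) = algebraMap A K (C q) := by
    intro σ q
    change IsFractionRing.ringEquivOfRingEquiv (ψ σ) (algebraMap A K (C q)) = _
    rw [IsFractionRing.ringEquivOfRingEquiv_algebraMap]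
    change algebraMap A K (rename σ (C q)) = _
    rw [rename_C]
  letI act : MulSemiringAction (Equiv.Perm (Fin 3)) K := MulSemiringAction.compHom K φ
  let c : ℕ → K := fun n => algebraMap A K (C ((2 : ℚ) ^ n))
  let x : Fin 3 → K := fun i => algebraMap A K (X i)
  have hinj : Function.Injective (algebraMap A K) := IsFractionRing.injective A K
  have h2 : ∀ n : ℕ, ((2 : ℚ) ^ n) ≠ 0 := fun n => pow_ne_zero _ two_ne_zero
  have hpow : Function.Injective (fun n : ℕ => (2 : ℚ) ^ n) := pow_right_injective₀ (by norm_num) (by norm_num)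
  have tdeg_cx : ∀ (n : ℕ) (i : Fin 3), (C ((2 : ℚ) ^ n) * X i : A).totalDegree = 1 := by
    intro n i
    rw [C_mul_X_eq_monomial, totalDegree_monomial _ (h2 n), Finsupp.sum_single_index rfl]
  have tdeg_xx : ∀ i j : Fin 3, (X i * X j : A).totalDegree = 2 := by
    intro i j
    have hm : (X i * X j : A) = monomial (Finsupp.single i 1 + Finsupp.single j 1) 1 := by
      have hXi : (X i : A) = monomial (Finsupp.single i 1) 1 := (pow_one (X i)).symm.trans X_pow_eq_monomial
      have hXj : (X j : A) = monomial (Finsupp.single j 1) 1 := (pow_one (X j)).symm.trans X_pow_eq_monomial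
      rw [hXi, hXj, monomial_mul, mul_one]
    rw [hm, totalDegree_monomial _ one_ne_zero, Finsupp.sum_add_index' (fun _ => rfl) (fun _ _ _ => rfl),
      Finsupp.sum_single_index rfl, Finsupp.sum_single_index rfl]
  refine ⟨K, inferInstance, act, c, x, fun g n => hφC g _, fun g i => hφX g i,
    fun n m h => hpow (C_injective _ _ (hinj h)), fun i j h => X_injective (hinj h), ?_, ?_, ?_,
    fun n h => h2 n ((C_eq_zero.1 ((map_eq_zero_iff _ hinj).1 h))),
    fun i h => X_ne_zero i ((map_eq_zero_iff _ hinj).1 h), ?_, ?_⟩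
  · intro n i h
    have h' := congrArg totalDegree (hinj h)
    rw [totalDegree_C, totalDegree_X] at h'
    exact zero_ne_one h'
  · change algebraMap A K (C ((2 : ℚ) ^ 0)) = 1
    rw [pow_zero, C_1, map_one]
  · intro a b
    change algebraMap A K _ * algebraMap A K _ = algebraMap A K _
    rw [← map_mul, ← C_mul, ← pow_add]
  · rintro n i (⟨m, hm⟩ | ⟨j, hj⟩)
    · exfalso
      have h' := congrArg totalDegree (hinj ((map_mul _ _ _).trans hm.symm))
      rw [tdeg_cx, totalDegree_C] at h'
      exact one_ne_zero h'
    · have h' := hinj ((map_mul _ _ _).trans hj.symm)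
      rw [C_mul_X_eq_monomial, ← one_mul (X j : A), ← C_1, C_mul_X_eq_monomial, monomial_eq_monomial_iff] at h'
      rcases h' with ⟨-, h1⟩ | ⟨h1, -⟩
      · exact hpow (h1.trans (pow_zero _).symm)
      · exact absurd h1 (h2 n)
  · rintro i j (⟨m, hm⟩ | ⟨k, hk⟩)
    · have h' := congrArg totalDegree (hinj ((map_mul _ _ _).trans hm.symm))
      rw [tdeg_xx, totalDegree_C] at h'
      exact two_ne_zero h'
    · have h' := congrArg totalDegree (hinj ((map_mul _ _ _).trans hk.symm))
      rw [tdeg_xx, totalDegree_X] at h'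
      exact absurd h' (by decide)

/-- **The Kummer container of the toy.**  There are a commutative group `H` with an action of `S₃` and an action of
`Ẑ^× = Aut(Ẑ)`, an injective additive ray `z : ℕ → H` fixed by `S₃`, an injective family `v : Fin 3 → H` permuted by
`S₃`, never meeting the ray and with the product-exclusion pattern of `exists_S3Field`, such that the `Ẑ^×`-action
transports the ray EXACTLY as the divisor-transport law (b′) of [IUTchI] Ex 5.1 (v) demands (`z m = u • z n` iff
`u (η n) = η m` — here only the needed direction), together with a homomorphism `r` to a commutative group under
which the ray is torsion and the `v i` are not.  [Model: `H = Ẑ × ℤ³`, `z n = (η n, 0)`, `v i = (1, eᵢ)`, `u` acting on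
the `Ẑ` factor (the tree's REAL `ZHatLevel.eta` / `MulAut Ẑ`), `S₃` permuting `ℤ³`, `r` = the projection to `ℤ³`.]
([IUTchI] Ex 5.1 (v) pp.127–128) [claim: Mochizuki2012, status: disputed] -/
theorem exists_container :
    ∃ (H : Type) (_ : CommGroup H) (_ : MulAction (Equiv.Perm (Fin 3)) H)
      (_ : MulAction (MulAut (completion (GrpCat.of (Multiplicative ℤ)))) H)
      (z : ℕ → H) (v : Fin 3 → H) (T : Type) (_ : CommGroup T) (r : H →* T),
      Function.Injective z ∧ Function.Injective v ∧ (∀ n i, z n ≠ v i) ∧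
      (∀ a b, z a * z b = z (a + b)) ∧
      (∀ n i, z n * v i ∈ Set.range z ∪ Set.range v → n = 0) ∧
      (∀ i j, v i * v j ∉ Set.range z ∪ Set.range v) ∧
      (∀ (g : Equiv.Perm (Fin 3)) (n : ℕ), g • z n = z n) ∧
      (∀ (g : Equiv.Perm (Fin 3)) (i : Fin 3), g • v i = v (g i)) ∧
      (∀ (u : MulAut (completion (GrpCat.of (Multiplicative ℤ)))) (n m : ℕ),
        z m = u • z n → u (eta n) = eta m) ∧
      (∀ n, IsOfFinOrder (r (z n))) ∧ (∀ i, ¬ IsOfFinOrder (r (v i))) := by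
  classical
  letI zhatCommGroup : CommGroup (completion (GrpCat.of (Multiplicative ℤ))) :=
    { (inferInstance : Group (completion (GrpCat.of (Multiplicative ℤ)))) with
      mul_comm := ZHatCompletion.mul_comm }
  let H : Type := completion (GrpCat.of (Multiplicative ℤ)) × (Fin 3 → Multiplicative ℤ)
  letI actH : MulAction (Equiv.Perm (Fin 3)) H :=
    { smul := fun g h => (h.1, fun i => h.2 (g⁻¹ i))
      one_smul := fun h => rfl
      mul_smul := fun g g' h => rfl }
  letI twH : MulAction (MulAut (completion (GrpCat.of (Multiplicative ℤ)))) H :=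
    { smul := fun u h => (u h.1, h.2)
      one_smul := fun h => rfl
      mul_smul := fun u u' h => rfl }
  let z : ℕ → H := fun n => (eta n, 1)
  let v : Fin 3 → H := fun i => (1, Pi.mulSingle i (Multiplicative.ofAdd (1 : ℤ)))
  -- the additive degree on `ℤ³`
  let deg : (Fin 3 → Multiplicative ℤ) → ℤ := fun w => ∑ i, Multiplicative.toAdd (w i)
  have deg_mul : ∀ w w', deg (w * w') = deg w + deg w' := by
    intro w w'
    change ∑ i, Multiplicative.toAdd ((w * w') i) =
      (∑ i, Multiplicative.toAdd (w i)) + ∑ i, Multiplicative.toAdd (w' i)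
    simp only [Pi.mul_apply, toAdd_mul, Finset.sum_add_distrib]
  have deg_single : ∀ i : Fin 3, deg (Pi.mulSingle i (Multiplicative.ofAdd (1 : ℤ))) = 1 := by
    intro i
    change ∑ j, Multiplicative.toAdd ((Pi.mulSingle i (Multiplicative.ofAdd (1 : ℤ)) :
      Fin 3 → Multiplicative ℤ) j) = (1 : ℤ)
    rw [Finset.sum_eq_single i (fun j _ hj => by rw [Pi.mulSingle_eq_of_ne hj, toAdd_one])
      (fun h => absurd (Finset.mem_univ i) h), Pi.mulSingle_eq_same, toAdd_ofAdd]
  have deg_one : deg 1 = 0 := by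
    change ∑ j, Multiplicative.toAdd ((1 : Fin 3 → Multiplicative ℤ) j) = (0 : ℤ)
    simp only [Pi.one_apply, toAdd_one, Finset.sum_const_zero]
  have deg_pow : ∀ (w : Fin 3 → Multiplicative ℤ) (n : ℕ), deg (w ^ n) = n * deg w := by
    intro w n
    induction n with
    | zero => rw [pow_zero, deg_one, Nat.cast_zero, zero_mul]
    | succ n ih => rw [pow_succ, deg_mul, ih, Nat.cast_succ, add_mul, one_mul]
  have eta_nat_add : ∀ a b : ℕ, eta a * eta b = eta ((a + b : ℕ) : ℤ) := by
    intro a b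
    rw [eta_eq_zpow (a : ℤ), eta_eq_zpow (b : ℤ), eta_eq_zpow ((a + b : ℕ) : ℤ), ← zpow_add, Nat.cast_add]
  have eta_nat_inj : ∀ a b : ℕ, eta a = eta b → a = b :=
    fun a b h => Nat.cast_injective (CyclotomeIsoIntegralLawsToy.eta_injective h)
  have single_ne_one : ∀ i : Fin 3,
      (Pi.mulSingle i (Multiplicative.ofAdd (1 : ℤ)) : Fin 3 → Multiplicative ℤ) ≠ 1 := by
    intro i h
    have h' := congrArg deg h
    rw [deg_single, deg_one] at h'
    exact one_ne_zero h'
  refine ⟨H, inferInstance, actH, twH, z, v, (Fin 3 → Multiplicative ℤ), inferInstance, MonoidHom.snd _ _,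
    fun a b h => eta_nat_inj a b (congrArg Prod.fst h), ?_, fun n i h => single_ne_one i (congrArg Prod.snd h).symm,
    ?_, ?_, ?_, fun g n => rfl, ?_, fun u n m h => (congrArg Prod.fst h).symm, fun n => ?_, fun i => ?_⟩
  · -- `v` is injective
    intro i j h
    have h' := congrFun (congrArg Prod.snd h) i
    change (Pi.mulSingle i (Multiplicative.ofAdd (1 : ℤ)) : Fin 3 → Multiplicative ℤ) i =
      (Pi.mulSingle j (Multiplicative.ofAdd (1 : ℤ)) : Fin 3 → Multiplicative ℤ) i at h'
    rw [Pi.mulSingle_eq_same] at h'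
    by_contra hij
    rw [Pi.mulSingle_eq_of_ne hij] at h'
    have h'' := congrArg Multiplicative.toAdd h'
    rw [toAdd_ofAdd, toAdd_one] at h''
    exact one_ne_zero h''
  · -- the ray is additive
    intro a b
    change (eta a * eta b, (1 : Fin 3 → Multiplicative ℤ) * 1) = (eta ((a + b : ℕ) : ℤ), 1)
    rw [eta_nat_add, mul_one]
  · -- `z n · v i` is a value only for `n = 0`
    rintro n i (⟨m, hm⟩ | ⟨j, hj⟩)
    · exfalso
      have h' := congrArg Prod.snd hm
      change (1 : Fin 3 → Multiplicative ℤ) = 1 * Pi.mulSingle i (Multiplicative.ofAdd (1 : ℤ)) at h'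
      rw [one_mul] at h'
      exact single_ne_one i h'.symm
    · have h' := congrArg Prod.fst hj
      change (1 : completion (GrpCat.of (Multiplicative ℤ))) = eta n * 1 at h'
      rw [mul_one, show (1 : completion (GrpCat.of (Multiplicative ℤ))) = eta ((0 : ℕ) : ℤ) by
        rw [Nat.cast_zero, eta_eq_zpow, zpow_zero]] at h'
      exact (eta_nat_inj _ _ h').symm
  · -- `v i · v j` is never a value
    rintro i j (⟨m, hm⟩ | ⟨k, hk⟩)
    · have h' := congrArg (fun h : H => deg h.2) hm
      change deg 1 = deg (Pi.mulSingle i _ * Pi.mulSingle j _) at h'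
      rw [deg_one, deg_mul, deg_single, deg_single] at h'
      omega
    · have h' := congrArg (fun h : H => deg h.2) hk
      change deg (Pi.mulSingle k _) = deg (Pi.mulSingle i _ * Pi.mulSingle j _) at h'
      rw [deg_mul, deg_single, deg_single, deg_single] at h'
      omega
  · -- `S₃` permutes the `v i`
    intro g i
    refine Prod.ext rfl (funext fun l => ?_)
    change (Pi.mulSingle i (Multiplicative.ofAdd (1 : ℤ)) : Fin 3 → Multiplicative ℤ) (g⁻¹ l) =
      (Pi.mulSingle (g i) (Multiplicative.ofAdd (1 : ℤ)) : Fin 3 → Multiplicative ℤ) l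
    simp only [Pi.mulSingle_apply, Equiv.Perm.inv_eq_iff_eq]
  · -- the ray is torsion under `r`
    change IsOfFinOrder (1 : Fin 3 → Multiplicative ℤ)
    exact IsOfFinOrder.one
  · -- the `v i` are not torsion under `r`
    change ¬ IsOfFinOrder (Pi.mulSingle i (Multiplicative.ofAdd (1 : ℤ)) : Fin 3 → Multiplicative ℤ)
    rw [isOfFinOrder_iff_pow_eq_one]
    rintro ⟨n, hn, h⟩
    have h' := congrArg deg h
    rw [deg_pow, deg_single, deg_one, mul_one] at h'
    omega

end CoricLawsToy

end NFBridgeRecon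

end Literature.IUT.HodgeTheaters
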